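import Literature.NumberTheory.LFunctions.SchoenfeldSieve

/-!
# Schoenfeld (6.18) on `[2659, 10⁸)` — block 16: `[80000000, 85000000)`

Topic: `Literature/NumberTheory/LFunctions`. COMPUTATIONAL (one `native_decide`): the cell loop of
`SchoenfeldSieve.lean` passes on `[80000000, 85000000)`, entering with `π(80000000 − 1) = 4669382` and leaving with
`π(85000000 − 1) = 4943731`. Consumed by `RHConditionalFactsSchoenfeldProofs.lean` through `SchoenfeldSieve.segOK_step`.

## References

* L. Schoenfeld, Math. Comp. 30 (1976), 337–360, proof of Cor. 1. [Schoenfeld1976]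
-/

namespace Literature.NumberTheory.LFunctions

namespace SchoenfeldSieve

/-- Block 16 of the certified check of (6.18): `checkSeg 80000000 85000000 4669382 4943731`. [folklore] -/
theorem checkSeg_16 : checkSeg 80000000 85000000 4669382 4943731 = true := by
  native_decide

end SchoenfeldSieve

end Literature.NumberTheory.LFunctions
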